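import Mathlib
import Summits.HodgeConjecture.HodgeConjecture.Theorems.HodgeLocusCensusUnitColumnRankD4
import Summits.HodgeConjecture.HodgeConjecture.Theorems.HodgeLocusCensusUnitColumnRankD3Deficit

/-!
# HodgeLocus census — THEOREM K-MODEL, `d = 4`: the characteristic-`2` DEFICIT table of anchor 174 as kernel theorems (ENGINE B, G49-B-D4DEF)

certified instances and evidence bearing on the general Hodge conjecture; no claim.

SETTING.  Anchor 174 (`HodgeLocusCensusUnitColumnRankD4`) certifies the rank of the `d = 4` cells of THEOREM K-MODEL on the model
`B = K[x₁,…,x_k]/(x₁³,…,x_k³)`, `q = Σ xᵢ²`: THEOREM (i) `rank_mulDelta_modelC1_d4` (`×q : B_{2k−4} → B_{2k−2}`, `k ≥ 3`: full row rank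
`k(k+1)/2`) and THEOREM (iii) `rank_mulDeltaSq_modelC2_d4` (`×q² : B_{2k−4} → B_{2k}`, `k ≥ 2`: rank `1`) under the hypothesis `(2 : K) ≠ 0`,
whose NECESSITY its docstring records as a checked numeric only ("in characteristic `2` the one-zero rows see only the incidence matrix of `K_k`
(rank `k−1`), and `q² = 2·Σ xᵢ²xⱼ² = 0`").  This sheet proves that deficit table about the SAME two matrices, copied from THEOREMS (i) and (iii)
of anchor 174 verbatim (rows/columns = exponent functions `Fin k → Fin 3` of the stated masses; entries read off gen 31's `colR 4`).

THEOREMS (kernel statements; `K` a field with `(2 : K) = 0`).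
 (M1) `rank_mulDelta_modelC1_d4_char_two` — every `k ≥ 3`:  `rank (×q) + 1 = card rows` (`= k(k+1)/2`, `…_eq_choose`; deficit exactly `1`);
 (M2) `mulDeltaSq_modelC2_d4_char_two`    — every `k`:      the multiplicity matrix of `×q²` is `0` (rank `0`, `rank_mulDeltaSq_modelC2_d4_char_two`).
With anchor 174 ((i), (iii) for `(2 : K) ≠ 0`; (ii) `rank_mulDelta_modelC1_d4_two`, `k = 2`, rank `1` of `3` rows over EVERY field — which is also the
sharpness of the threshold `k ≥ 3` in (M1)) every `d = 4` cell of THEOREM K-MODEL has its exact rank as a kernel theorem in EVERY characteristic; anchors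
168/172 (`d ≥ 5`, unit columns) carry no characteristic hypothesis, so the same now holds for every `d ≥ 4` cell with `dim B_{t−d} > 0`.

METHOD (minor-free; LAYER A‴ of anchor 188 and the entry lemmas of anchor 174 APPLIED BY NAME, nothing restated; no `decide`).
 (M1) UPPER `rank + 1 ≤ card rows` (`rank_add_one_le_card_of_vecMul_eq_zero`): the indicator `y` of the rows having a zero exponent (the `k` one-zero
 rows `r_a`) is a nonzero LEFT-KERNEL vector — a one-zero row occurs only in the columns of the pair-pattern sources `m_{xy}` (`two_zeros_of_mem`,
 `eq_pair_of_two_zeros`), and such a column is `e_{r_y} + e_{r_x}` (174's `entry_pair_iff`), meeting `y` in `1 + 1 = 2 = 0`.  LOWER `card rows ≤ rank + 1`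
 (`card_le_rank_add_card_of_single_mem_sup` with ONE hub `e_{r_z}`): a two-ones row is a unit column (174's `entry_single_iff`, a third index as `k ≥ 3`),
 and `e_{r_a} = col(m_{az}) − e_{r_z}` for `a ≠ z`.
 (M2) every multiplicity in `(colR 4 m).flatMap (colR 4)` is EVEN (`two_dvd_count_flatMap_colR`, induction along `colR`'s own recursion: a zero head
 raised first or second contributes the same count twice, a nonzero head passes the count to the tail), and an even natural number is `0` in `K`.
SCOPE (said plainly).  Explicit matrices read off gen 31's `colR`; that their ranks are the `ρ` of THEOREM K-MODEL is the record's step (outside Lean, as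
in the anchors).  Evidence-class upgrade (numerics → theorems) of anchor 174's NECESSITY sentence; no census number changes; nothing about Hodge loci beyond
the K-MODEL record; nothing about HC.  Second implementation: `check_d4deficit.py` (the two matrices from `colR 4` AND from polynomial algebra in
`ℤ[x]/(xᵢ³)`, identical for `k = 1..10`; exact ranks over `ℚ` / `GF(2)` / `GF(3)` / `GF(5)`; every identity above).
-/

set_option linter.dupNamespace false
set_option autoImplicit false

namespace Summit.HodgeConjecture.HodgeConjecture.HodgeLocus.Census.UnitColumnRankD4Deficit

open Module
open Summit.HodgeConjecture.HodgeConjecture.HodgeLocus.Census.ModelNonJumpC1All (colR)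
open Summit.HodgeConjecture.HodgeConjecture.HodgeLocus.Census.UnitColumnRankD4
open Summit.HodgeConjecture.HodgeConjecture.HodgeLocus.Census.UnitColumnRankD3Deficit
  (rank_add_one_le_card_of_vecMul_eq_zero card_le_rank_add_card_of_single_mem_sup)

/-! ## `d = 4` exponent functions: the one-zero rows `r_z` and the pair-pattern sources `m_{xy}` -/

/-- the row `r_z` (exponent `0` at `z`, `2` elsewhere) has mass `2k − 2` -/
theorem sum_single_zero {k : ℕ} (z : Fin k) :
    (∑ l : Fin k, ((if l = z then (0 : Fin 3) else 2 : Fin 3) : ℕ)) + 2 = k * 2 := by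
  have h := sum_levels ({z} : Finset (Fin k)) ∅ (Finset.disjoint_empty_right _)
  rw [Finset.card_singleton] at h
  simpa using h

/-- a source (mass `2k − 4`) with zero exponents at `x ≠ y` IS the pair pattern `m_{xy}`: every other exponent is `2` -/
theorem eq_pair_of_two_zeros {k : ℕ} (m : Fin k → Fin 3) (hm : (∑ i, (m i : ℕ)) + 4 = k * 2) (x y : Fin k) (hxy : x ≠ y)
    (hx : (m x : ℕ) = 0) (hy : (m y : ℕ) = 0) : m = fun l => if l = x ∨ l = y then (0 : Fin 3) else 2 := by
  have hle : ∀ l, (m l : ℕ) ≤ 2 := fun l => by have := (m l).2; omega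
  have hD : ∑ l, (2 - (m l : ℕ)) = 4 := by
    have h : ∑ l, ((2 - (m l : ℕ)) + (m l : ℕ)) = k * 2 := by
      rw [Finset.sum_congr rfl (fun l _ => Nat.sub_add_cancel (hle l))]; simp
    rw [Finset.sum_add_distrib] at h; omega
  funext l
  by_cases hl : l = x ∨ l = y
  · rw [if_pos hl]
    rcases hl with rfl | rfl
    · exact Fin.ext (by simpa using hx)
    · exact Fin.ext (by simpa using hy)
  · rw [if_neg hl]
    push Not at hl
    have h := Finset.sum_le_sum_of_subset (f := fun i => 2 - (m i : ℕ)) (Finset.subset_univ ({x, y, l} : Finset (Fin k)))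
    rw [Finset.sum_insert (by simp [hxy, Ne.symm hl.1]), Finset.sum_pair (Ne.symm hl.2), hD] at h
    have := hle l
    exact Fin.ext (by simp; omega)

/-- (SHAPE′) a row with a zero exponent at `a` occurs in the column of a source `m` only if `m` has two distinct zero exponents -/
theorem two_zeros_of_mem {k : ℕ} (m w : Fin k → Fin 3) (a : Fin k) (ha : (w a : ℕ) = 0)
    (h : List.ofFn (fun i => (w i : ℕ)) ∈ colR 4 (List.ofFn fun i => (m i : ℕ))) :
    ∃ x y : Fin k, x ≠ y ∧ (m x : ℕ) = 0 ∧ (m y : ℕ) = 0 := by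
  obtain ⟨i, hi0, hi2, hoff⟩ := (ofFn_mem_colR_iff (d := 4) m w).mp h
  have hia : a ≠ i := fun hai => by subst hai; omega
  exact ⟨i, a, Ne.symm hia, hi0, by rw [← hoff a hia]; exact ha⟩

/-- the `×q` entry at a pair-pattern source `m_{xy}`: `[w = r_y] + [w = r_x]` (anchor 174's `entry_pair_iff`, the source given by an equation so that an
arbitrary column can be rewritten under a binder) -/
theorem entry_pair_eq {K : Type*} [Field K] {k : ℕ} (m : Fin k → Fin 3) (x y : Fin k) (hxy : x ≠ y)
    (hm : m = fun l => if l = x ∨ l = y then (0 : Fin 3) else 2) (w : Fin k → Fin 3) :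
    (if List.ofFn (fun i => (w i : ℕ)) ∈ colR 4 (List.ofFn fun i => (m i : ℕ)) then (1 : K) else 0) =
      (if w = (fun l => if l = y then (0 : Fin 3) else 2) then (1 : K) else 0) +
      (if w = (fun l => if l = x then (0 : Fin 3) else 2) then (1 : K) else 0) := by
  subst hm
  have hne : (fun l => if l = y then (0 : Fin 3) else 2) ≠ (fun l => if l = x then (0 : Fin 3) else 2) := fun h => by
    have e := congrFun h y
    simp [Ne.symm hxy] at e
  by_cases h1 : w = (fun l => if l = y then (0 : Fin 3) else 2)
  · rw [if_pos ((entry_pair_iff x y hxy w).mpr (Or.inl h1)), if_pos h1, if_neg (fun h2 => hne (h1.symm.trans h2)), add_zero]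
  by_cases h2 : w = (fun l => if l = x then (0 : Fin 3) else 2)
  · rw [if_pos ((entry_pair_iff x y hxy w).mpr (Or.inr h2)), if_neg h1, if_pos h2, zero_add]
  · rw [if_neg (fun h => ((entry_pair_iff x y hxy w).mp h).elim h1 h2), if_neg h1, if_neg h2, add_zero]

/-- a sum over the rows against the indicator of one row picks the weight there -/
theorem sum_mul_ite_row {K : Type*} [Field K] {k j : ℕ} (y : {v : Fin k → Fin 3 // (∑ i, (v i : ℕ)) + j = k * 2} → K)
    (f : Fin k → Fin 3) (hf : (∑ i, (f i : ℕ)) + j = k * 2) :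
    (∑ v : {v : Fin k → Fin 3 // (∑ i, (v i : ℕ)) + j = k * 2}, y v * (if v.1 = f then (1 : K) else 0)) = y ⟨f, hf⟩ := by
  rw [Finset.sum_eq_single ⟨f, hf⟩ (fun v _ hv => by rw [if_neg fun h => hv (Subtype.ext h), mul_zero])
    (fun h => absurd (Finset.mem_univ _) h), if_pos rfl, mul_one]

/-! ## (M1) — `×q : B_{2k−4} → B_{2k−2}` in characteristic `2`: deficit exactly `1` -/

/-- (M1)  `(2 : K) = 0`, `k ≥ 3`: the indicator matrix of `×q : B_{2k−4} → B_{2k−2}` (THEOREM (i) of anchor 174) has rank `card rows − 1`. -/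
theorem rank_mulDelta_modelC1_d4_char_two (K : Type*) [Field K] (h2 : (2 : K) = 0) (k : ℕ) (hk : 3 ≤ k) :
    (Matrix.of fun (v : {v : Fin k → Fin 3 // (∑ i, (v i : ℕ)) + 2 = k * 2})
        (m : {m : Fin k → Fin 3 // (∑ i, (m i : ℕ)) + 4 = k * 2}) =>
      if List.ofFn (fun i => (v.1 i : ℕ)) ∈ colR 4 (List.ofFn (fun i => (m.1 i : ℕ))) then (1 : K) else 0).rank + 1 =
      Fintype.card {v : Fin k → Fin 3 // (∑ i, (v i : ℕ)) + 2 = k * 2} := by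
  set A := (Matrix.of fun (v : {v : Fin k → Fin 3 // (∑ i, (v i : ℕ)) + 2 = k * 2})
        (m : {m : Fin k → Fin 3 // (∑ i, (m i : ℕ)) + 4 = k * 2}) =>
      if List.ofFn (fun i => (v.1 i : ℕ)) ∈ colR 4 (List.ofFn (fun i => (m.1 i : ℕ))) then (1 : K) else 0) with hA
  have colA : ∀ (c : {m : Fin k → Fin 3 // (∑ i, (m i : ℕ)) + 4 = k * 2}) (w : {v : Fin k → Fin 3 // (∑ i, (v i : ℕ)) + 2 = k * 2}),
      A.col c w = if List.ofFn (fun i => (w.1 i : ℕ)) ∈ colR 4 (List.ofFn (fun i => (c.1 i : ℕ))) then (1 : K) else 0 :=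
    fun _ _ => rfl
  obtain ⟨z⟩ : Nonempty (Fin k) := ⟨⟨0, by omega⟩⟩
  -- the pair-pattern column `m_{xy}` is `e_{r_y} + e_{r_x}`: a member of the column span (174's `entry_pair_iff`)
  have hpair : ∀ x y : Fin k, x ≠ y →
      ((fun w => if w.1 = (fun l => if l = y then (0 : Fin 3) else 2) then (1 : K) else 0) +
        (fun w => if w.1 = (fun l => if l = x then (0 : Fin 3) else 2) then (1 : K) else 0) :
        {v : Fin k → Fin 3 // (∑ i, (v i : ℕ)) + 2 = k * 2} → K) ∈ Submodule.span K (Set.range A.col) := by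
    intro x y hxy
    refine Submodule.subset_span ⟨⟨fun l => if l = x ∨ l = y then 0 else 2, sum_pair x y hxy⟩, funext fun w => ?_⟩
    rw [colA, Pi.add_apply]; exact entry_pair_eq _ x y hxy rfl w.1
  -- a witness that a one-zero row has a zero exponent
  have hex : ∀ x : Fin k, ∃ a : Fin k, (((if a = x then (0 : Fin 3) else 2 : Fin 3)) : ℕ) = 0 := fun x => ⟨x, by simp⟩
  -- UPPER: the indicator of the one-zero rows is a nonzero LEFT-KERNEL vector
  have hup : A.rank + 1 ≤ Fintype.card {v : Fin k → Fin 3 // (∑ i, (v i : ℕ)) + 2 = k * 2} := by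
    refine rank_add_one_le_card_of_vecMul_eq_zero A (fun v => if ∃ a, (v.1 a : ℕ) = 0 then (1 : K) else 0) ?_ (funext fun m₀ => ?_)
    · refine Function.ne_iff.mpr ⟨⟨fun l => if l = z then 0 else 2, sum_single_zero z⟩, ?_⟩
      rw [if_pos (hex z)]; exact one_ne_zero
    · show (∑ v, (if ∃ a, (v.1 a : ℕ) = 0 then (1 : K) else 0) * A v m₀) = 0
      by_cases hm2 : ∃ x y : Fin k, x ≠ y ∧ (m₀.1 x : ℕ) = 0 ∧ (m₀.1 y : ℕ) = 0
      · obtain ⟨x, y, hxy, hx, hy⟩ := hm2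
        have hm := eq_pair_of_two_zeros m₀.1 m₀.2 x y hxy hx hy
        simp_rw [hA, Matrix.of_apply, entry_pair_eq _ x y hxy hm, mul_add, Finset.sum_add_distrib, sum_mul_ite_row _ _ (sum_single_zero y),
          sum_mul_ite_row _ _ (sum_single_zero x)]
        rw [if_pos (hex y), if_pos (hex x), one_add_one_eq_two, h2]
      · refine Finset.sum_eq_zero fun v _ => ?_
        by_cases hv : ∃ a, (v.1 a : ℕ) = 0
        · obtain ⟨a, ha⟩ := hv
          rw [hA, Matrix.of_apply, if_neg (fun hmem => hm2 (two_zeros_of_mem m₀.1 v.1 a ha hmem)), mul_zero]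
        · rw [if_neg hv, zero_mul]
  -- LOWER: with the ONE hub `e_{r_z}` the columns span every unit vector
  have hlow : Fintype.card {v : Fin k → Fin 3 // (∑ i, (v i : ℕ)) + 2 = k * 2} ≤ A.rank + 1 := by
    let rz : {v : Fin k → Fin 3 // (∑ i, (v i : ℕ)) + 2 = k * 2} := ⟨fun l => if l = z then 0 else 2, sum_single_zero z⟩
    have hhub : (Pi.single rz (1 : K) : _ → K) ∈ Submodule.span K (Set.range fun _ : Unit => (Pi.single rz (1 : K) : _ → K)) :=
      Submodule.subset_span ⟨(), rfl⟩
    have h := card_le_rank_add_card_of_single_mem_sup (ι := Unit) A (fun _ => Pi.single rz (1 : K)) ?_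
    · simpa using h
    rintro ⟨s, hs⟩
    rcases row_shape_d4 s hs with ⟨a, ha0, ha2⟩ | ⟨a, b, hab, ha1, hb1, hrest⟩
    · -- a one-zero row `r_a`: the hub itself, or `col(m_{az}) − e_{r_z}`
      have hs' : s = fun l => if l = a then (0 : Fin 3) else 2 := funext fun l => by
        by_cases hl : l = a
        · rw [if_pos hl, hl]; exact Fin.ext (by simpa using ha0)
        · rw [if_neg hl]; exact Fin.ext (by simpa using ha2 l hl)
      subst hs'
      by_cases haz : a = z
      · subst haz; exact Submodule.mem_sup_right hhub
      have hmem := Submodule.sub_mem _ (Submodule.mem_sup_left (T := Submodule.span K (Set.range fun _ : Unit => (Pi.single rz (1 : K) : _ → K)))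
        (hpair a z haz)) (Submodule.mem_sup_right (S := Submodule.span K (Set.range A.col)) hhub)
      convert hmem using 1
      funext w
      simp only [Pi.single_apply, Pi.add_apply, Pi.sub_apply, Subtype.ext_iff, rz]
      ring
    · -- a two-ones row: a unit column (174's `entry_single_iff`)
      obtain ⟨c, hca, hcb⟩ := exists_third hk a b
      have hs' : s = fun l => if l = a ∨ l = b then (1 : Fin 3) else 2 := funext fun l => by
        by_cases hl : l = a ∨ l = b
        · rw [if_pos hl]
          rcases hl with rfl | rfl
          · exact Fin.ext (by simpa using ha1)
          · exact Fin.ext (by simpa using hb1)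
        · rw [if_neg hl]; push Not at hl; exact Fin.ext (by simpa using hrest l hl.1 hl.2)
      subst hs'
      refine Submodule.mem_sup_left (Submodule.subset_span
        ⟨⟨fun l => if l = c then 0 else if l = a ∨ l = b then 1 else 2, sum_zero_ones_at a b c hab hca hcb⟩, ?_⟩)
      funext w; rw [colA]; dsimp only; simp only [entry_single_iff a b c hca hcb w.1, Pi.single_apply, Subtype.ext_iff]
  omega

/-- (M1) with the count (174's `card_rows_d4`): in characteristic `2`, `rank (×q : B_{2k−4} → B_{2k−2}) + 1 = k(k+1)/2`, `k ≥ 3`. -/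
theorem rank_mulDelta_modelC1_d4_char_two_eq_choose (K : Type*) [Field K] (h2 : (2 : K) = 0) (k : ℕ) (hk : 3 ≤ k) :
    (Matrix.of fun (v : {v : Fin k → Fin 3 // (∑ i, (v i : ℕ)) + 2 = k * 2})
        (m : {m : Fin k → Fin 3 // (∑ i, (m i : ℕ)) + 4 = k * 2}) =>
      if List.ofFn (fun i => (v.1 i : ℕ)) ∈ colR 4 (List.ofFn (fun i => (m.1 i : ℕ))) then (1 : K) else 0).rank + 1 = k * (k + 1) / 2 := by
  rw [rank_mulDelta_modelC1_d4_char_two K h2 k hk, card_rows_d4]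

/-! ## (M2) — `×q² : B_{2k−4} → B_{2k}` in characteristic `2`: the zero matrix -/

/-- a nonzero head is carried along: `colR 4 (x :: u) = (colR 4 u).map (x :: ·)` -/
theorem colR_cons_of_ne_zero (x : ℕ) (hx : x ≠ 0) (u : List ℕ) : colR 4 (x :: u) = (colR 4 u).map (List.cons x) := by
  simp [colR, hx]

/-- a zero head is raised to `2` or carried along: `colR 4 (0 :: u) = (2 :: u) :: (colR 4 u).map (0 :: ·)` -/
theorem colR_cons_zero (u : List ℕ) : colR 4 (0 :: u) = (2 :: u) :: (colR 4 u).map (List.cons 0) := by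
  simp [colR]

/-- counting a prefixed word in a prefixed list: only the matching head counts -/
theorem count_map_cons (x : ℕ) (L : List (List ℕ)) :
    ∀ w : List ℕ, (L.map (List.cons x)).count w = match w with | [] => 0 | x' :: w' => if x' = x then L.count w' else 0
  | [] => List.count_eq_zero.mpr (by simp)
  | x' :: w' => by
      dsimp only
      split_ifs with h
      · subst h; exact List.count_map_of_injective _ _ List.cons_injective w'
      · exact List.count_eq_zero.mpr (by
          simp only [List.mem_map, not_exists, not_and]
          exact fun u _ hu => h (List.cons.inj hu).1.symm)

/-- flat-mapping `colR 4` over words prefixed by a NONZERO `x` = prefixing the flat-map -/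
theorem flatMap_colR_map_cons_of_ne_zero (x : ℕ) (hx : x ≠ 0) :
    ∀ L : List (List ℕ), (L.map (List.cons x)).flatMap (colR 4) = (L.flatMap (colR 4)).map (List.cons x)
  | [] => by simp
  | u :: L => by
      rw [List.map_cons, List.flatMap_cons, List.flatMap_cons, List.map_append, colR_cons_of_ne_zero x hx u,
        flatMap_colR_map_cons_of_ne_zero x hx L]

/-- flat-mapping `colR 4` over words prefixed by `0`: each word once with head `2`, plus the prefixed flat-map — as counts -/
theorem count_flatMap_colR_map_cons_zero (w : List ℕ) :
    ∀ L : List (List ℕ), ((L.map (List.cons 0)).flatMap (colR 4)).count w =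
      (L.map (List.cons 2)).count w + ((L.flatMap (colR 4)).map (List.cons 0)).count w
  | [] => by simp
  | u :: L => by
      rw [List.map_cons, List.flatMap_cons, List.count_append, colR_cons_zero u, List.count_cons, count_flatMap_colR_map_cons_zero w L,
        List.map_cons, List.count_cons, List.flatMap_cons, List.map_append, List.count_append]
      omega

/-- every multiplicity in `q·(q·x^m)` is EVEN: the two zero exponents raised can be raised in either order -/
theorem two_dvd_count_flatMap_colR : ∀ (m w : List ℕ), 2 ∣ ((colR 4 m).flatMap (colR 4)).count w
  | [], w => by simp [colR]
  | x :: u, w => by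
      by_cases hx : x = 0
      · subst hx
        rw [colR_cons_zero, List.flatMap_cons, List.count_append, colR_cons_of_ne_zero 2 two_ne_zero,
          count_flatMap_colR_map_cons_zero, ← add_assoc, ← two_mul]
        refine dvd_add (dvd_mul_right 2 _) ?_
        rw [count_map_cons]
        rcases w with _ | ⟨x', w'⟩
        · exact dvd_zero 2
        · dsimp only; split_ifs
          · exact two_dvd_count_flatMap_colR u w'
          · exact dvd_zero 2
      · rw [colR_cons_of_ne_zero x hx, flatMap_colR_map_cons_of_ne_zero x hx, count_map_cons]
        rcases w with _ | ⟨x', w'⟩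
        · exact dvd_zero 2
        · dsimp only; split_ifs
          · exact two_dvd_count_flatMap_colR u w'
          · exact dvd_zero 2

/-- (M2)  `(2 : K) = 0`, every `k`: the multiplicity matrix of `×q² : B_{2k−4} → B_{2k}` (THEOREM (iii) of anchor 174) is `0` (`q² = 2·e₂(x²)` in `B`). -/
theorem mulDeltaSq_modelC2_d4_char_two (K : Type*) [Field K] (h2 : (2 : K) = 0) (k : ℕ) :
    (Matrix.of fun (v : {v : Fin k → Fin 3 // (∑ i, (v i : ℕ)) = k * 2})
        (m : {m : Fin k → Fin 3 // (∑ i, (m i : ℕ)) + 4 = k * 2}) =>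
      ((((colR 4 (List.ofFn (fun i => (m.1 i : ℕ)))).flatMap (colR 4)).count (List.ofFn (fun i => (v.1 i : ℕ))) : ℕ) : K)) = 0 := by
  ext v m
  obtain ⟨c, hc⟩ := two_dvd_count_flatMap_colR (List.ofFn fun i => (m.1 i : ℕ)) (List.ofFn fun i => (v.1 i : ℕ))
  rw [Matrix.of_apply, Matrix.zero_apply, hc, Nat.cast_mul, Nat.cast_ofNat, h2, zero_mul]

/-- (M2) as a rank: in characteristic `2` the `×q²` cell `(c′ = 2, d = 4)` has rank `0` for every `k` (anchor 174 (iii): rank `1` when `(2 : K) ≠ 0`). -/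
theorem rank_mulDeltaSq_modelC2_d4_char_two (K : Type*) [Field K] (h2 : (2 : K) = 0) (k : ℕ) :
    (Matrix.of fun (v : {v : Fin k → Fin 3 // (∑ i, (v i : ℕ)) = k * 2})
        (m : {m : Fin k → Fin 3 // (∑ i, (m i : ℕ)) + 4 = k * 2}) =>
      ((((colR 4 (List.ofFn (fun i => (m.1 i : ℕ)))).flatMap (colR 4)).count (List.ofFn (fun i => (v.1 i : ℕ))) : ℕ) : K)).rank = 0 := by
  rw [mulDeltaSq_modelC2_d4_char_two K h2 k, Matrix.rank_zero]

end Summit.HodgeConjecture.HodgeConjecture.HodgeLocus.Census.UnitColumnRankD4Deficit
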